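import Mathlib.Data.Finset.Card
import Mathlib.Data.Rat.Defs
import Mathlib.Tactic.NormNum
import Mathlib.Tactic.Linarith
import Mathlib.Tactic.Ring
import Mathlib.Algebra.Order.Ring.Abs

/-!
# [EtTh] §5, Proposition 5.3 (v): the "4 versus 5 or 6" count on the chain of components (pure combinatorics)

Mochizuki, *The étale theta function …*, Publ. RIMS **45** (2009)
[cite: MochizukiEtTh2009, Prop 5.3 proof p.326–327 (PDF pp.100–101); §1 p.239–240 (PDF pp.13–14)].
Seat abc-iut-L6-d1 (gen 3); Mathlib-only, proof-only lemma file for the GAP-LEDGER row G-L2d4-2 (the adjacency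
criterion of Prop. 5.3 (v) from the intersection theory of the chain, `FrobenioidThetaDivisorSupportAdjacency.lean`).

On the "infinite chain of copies of the projective line" with components `n_i`, `i ∈ ℤ` (p.239–240 (PDF pp.13–14)),
the divisor `n_p + n_q` (`p ≠ q`) has degree `[i = p+1] − 2[i = p] + [i = p−1] + [i = q+1] − 2[i = q] + [i = q−1]`
on `n_i`.  This file proves the two counting facts behind "[Here, the numbers '4', '5', '6' correspond to the
number of non-cuspidal primes that are either contained in or adjacent to a prime contained in the support of
`a + b`.]" (p.327 (PDF p.101)): that degree is non-zero EXACTLY on the six labels `p−1, p, p+1, q−1, q, q+1`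
(`chainDeg_ne_zero_iff`), and these six labels are `4` distinct components iff `|p − q| = 1`, `5` or `6` iff not
(`chainNbhd_card_eq_four_iff`, `chainNbhd_card_eq_five_or_six_iff`).
HONEST FRAMING: elementary arithmetic on `ℤ`; nothing here concerns an actual curve. -/

namespace Literature.AnabelianGeometry.EtaleTheta

namespace FrobenioidThetaDivisors

/-! ### The six components meeting `n_p + n_q` -/

/-- For `q = p + 1` the six labels `p−1, p, p+1, q−1, q, q+1` are `4` components.
[cite: MochizukiEtTh2009, Prop 5.3 proof p.327 (PDF p.101)] -/
theorem chainNbhd_card_of_eq_add_one {p q : ℤ} (h : q = p + 1) :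
    ({p - 1, p, p + 1, q - 1, q, q + 1} : Finset ℤ).card = 4 := by
  subst h
  rw [Finset.card_insert_of_notMem ?_, Finset.card_insert_of_mem ?_, Finset.card_insert_of_mem ?_,
    Finset.card_insert_of_notMem ?_, Finset.card_insert_of_notMem ?_, Finset.card_singleton]
  all_goals (simp only [Finset.mem_insert, Finset.mem_singleton, or_true, true_or]; try omega)

/-- For `q = p + 2` the six labels are `5` components. [cite: MochizukiEtTh2009, Prop 5.3 proof p.327 (PDF p.101)] -/
theorem chainNbhd_card_of_eq_add_two {p q : ℤ} (h : q = p + 2) :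
    ({p - 1, p, p + 1, q - 1, q, q + 1} : Finset ℤ).card = 5 := by
  subst h
  rw [Finset.card_insert_of_notMem ?_, Finset.card_insert_of_notMem ?_, Finset.card_insert_of_mem ?_,
    Finset.card_insert_of_notMem ?_, Finset.card_insert_of_notMem ?_, Finset.card_singleton]
  all_goals (simp only [Finset.mem_insert, Finset.mem_singleton]; try omega)

/-- For `q ≥ p + 3` the six labels are `6` components. [cite: MochizukiEtTh2009, Prop 5.3 proof p.327 (PDF p.101)] -/
theorem chainNbhd_card_of_add_three_le {p q : ℤ} (h : p + 3 ≤ q) :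
    ({p - 1, p, p + 1, q - 1, q, q + 1} : Finset ℤ).card = 6 := by
  rw [Finset.card_insert_of_notMem ?_, Finset.card_insert_of_notMem ?_, Finset.card_insert_of_notMem ?_,
    Finset.card_insert_of_notMem ?_, Finset.card_insert_of_notMem ?_, Finset.card_singleton]
  all_goals (simp only [Finset.mem_insert, Finset.mem_singleton]; try omega)

/-- The six labels are symmetric in `p, q`. [cite: MochizukiEtTh2009, Prop 5.3 proof p.327 (PDF p.101)] -/
theorem chainNbhd_comm (p q : ℤ) :
    ({p - 1, p, p + 1, q - 1, q, q + 1} : Finset ℤ) = {q - 1, q, q + 1, p - 1, p, p + 1} := by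
  ext i
  simp only [Finset.mem_insert, Finset.mem_singleton]
  tauto

/-- The number of distinct components among the six labels is `4`, `5` or `6` according as `|p − q| = 1`, `= 2`,
`≥ 3`.  [cite: MochizukiEtTh2009, Prop 5.3 proof p.327 (PDF p.101)] -/
theorem chainNbhd_card {p q : ℤ} (hpq : p ≠ q) :
    (|p - q| = 1 → ({p - 1, p, p + 1, q - 1, q, q + 1} : Finset ℤ).card = 4) ∧
    (|p - q| = 2 → ({p - 1, p, p + 1, q - 1, q, q + 1} : Finset ℤ).card = 5) ∧
    (3 ≤ |p - q| → ({p - 1, p, p + 1, q - 1, q, q + 1} : Finset ℤ).card = 6) := by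
  rcases lt_or_gt_of_ne hpq with hlt | hlt
  · refine ⟨fun h => ?_, fun h => ?_, fun h => ?_⟩
    · exact chainNbhd_card_of_eq_add_one (by rw [abs_of_neg (by omega)] at h; omega)
    · exact chainNbhd_card_of_eq_add_two (by rw [abs_of_neg (by omega)] at h; omega)
    · exact chainNbhd_card_of_add_three_le (by rw [abs_of_neg (by omega)] at h; omega)
  · rw [chainNbhd_comm]
    refine ⟨fun h => ?_, fun h => ?_, fun h => ?_⟩
    · exact chainNbhd_card_of_eq_add_one (by rw [abs_of_pos (by omega)] at h; omega)
    · exact chainNbhd_card_of_eq_add_two (by rw [abs_of_pos (by omega)] at h; omega)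
    · exact chainNbhd_card_of_add_three_le (by rw [abs_of_pos (by omega)] at h; omega)

/-- **"4" iff adjacent**: `p, q` (`p ≠ q`) are adjacent (`|p − q| = 1`) iff the six labels are `4` components.
[cite: MochizukiEtTh2009, Prop 5.3 proof p.326–327 (PDF pp.100–101)] -/
theorem chainNbhd_card_eq_four_iff {p q : ℤ} (hpq : p ≠ q) :
    ({p - 1, p, p + 1, q - 1, q, q + 1} : Finset ℤ).card = 4 ↔ |p - q| = 1 := by
  obtain ⟨h1, h2, h3⟩ := chainNbhd_card hpq
  refine ⟨fun h => ?_, h1⟩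
  by_contra hne
  have hpos : 0 < |p - q| := abs_pos.mpr (sub_ne_zero.mpr hpq)
  rcases (show |p - q| = 2 ∨ 3 ≤ |p - q| by omega) with h' | h'
  · rw [h2 h'] at h; omega
  · rw [h3 h'] at h; omega

/-- **"5 or 6" iff not adjacent**: for `p ≠ q`, the six labels are `5` or `6` components iff `|p − q| ≠ 1`.
[cite: MochizukiEtTh2009, Prop 5.3 proof p.326–327 (PDF pp.100–101)] -/
theorem chainNbhd_card_eq_five_or_six_iff {p q : ℤ} (hpq : p ≠ q) :
    (({p - 1, p, p + 1, q - 1, q, q + 1} : Finset ℤ).card = 5 ∨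
      ({p - 1, p, p + 1, q - 1, q, q + 1} : Finset ℤ).card = 6) ↔ |p - q| ≠ 1 := by
  obtain ⟨h1, h2, h3⟩ := chainNbhd_card hpq
  constructor
  · rintro (h | h) h' <;> · rw [h1 h'] at h; omega
  · intro hne
    have hpos : 0 < |p - q| := abs_pos.mpr (sub_ne_zero.mpr hpq)
    rcases (show |p - q| = 2 ∨ 3 ≤ |p - q| by omega) with h' | h'
    · exact Or.inl (h2 h')
    · exact Or.inr (h3 h')

/-! ### The degree of `n_p + n_q` on `n_i` -/

/-- **The degree of `n_p + n_q` on the component `n_i` is non-zero exactly on the six labels** (`p ≠ q`):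
`[i = p+1] − 2[i = p] + [i = p−1] + [i = q+1] − 2[i = q] + [i = q−1] ≠ 0 ↔ i ∈ {p−1, p, p+1, q−1, q, q+1}` — each
neighbouring component meets `n_p` in one node and `n_p · n_p = −2` (§1 p.239–240: "joined at `0` and `∞`"; the
special fibre is principal).  Values in `ℚ` (the coordinates of the divisor data are rational).
[cite: MochizukiEtTh2009, Prop 5.3 proof p.326–327 (PDF pp.100–101); §1 p.239–240 (PDF pp.13–14)] -/
theorem chainDeg_ne_zero_iff {p q : ℤ} (hpq : p ≠ q) (i : ℤ) :
    ((if i = p + 1 then (1 : ℚ) else 0) - 2 * (if i = p then 1 else 0) + (if i = p - 1 then 1 else 0) +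
      ((if i = q + 1 then (1 : ℚ) else 0) - 2 * (if i = q then 1 else 0) + (if i = q - 1 then 1 else 0))) ≠ 0 ↔
    i ∈ ({p - 1, p, p + 1, q - 1, q, q + 1} : Finset ℤ) := by
  constructor
  · intro h
    by_contra hi
    simp only [Finset.mem_insert, Finset.mem_singleton, not_or] at hi
    obtain ⟨h1, h2, h3, h4, h5, h6⟩ := hi
    rw [if_neg h3, if_neg h2, if_neg h1, if_neg h6, if_neg h5, if_neg h4] at h
    norm_num at h
  · intro hi
    simp only [Finset.mem_insert, Finset.mem_singleton] at hi
    rcases hi with rfl | rfl | rfl | rfl | rfl | rfl <;>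
    · split_ifs <;> first | (exfalso; omega) | norm_num

end FrobenioidThetaDivisors

end Literature.AnabelianGeometry.EtaleTheta
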